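import Literature.Probability.RandomPlanarGeometry.SLEMarkovKernelDeterministic
import Literature.Probability.RandomPlanarGeometry.SLEKernelFunctional
import Literature.Probability.RandomPlanarGeometry.LoewnerDescriptionProofs
import HarnessLib

/-!
# The domain-Markov kernel of chordal SLE_κ: the Borel read-off of the kernel value

Topic `Probability/RandomPlanarGeometry`; theorems and definitions (companion of
`SLEMarkovKernel.lean`, crux `stmt-CriticalPhenomena-0698`, stub `stub_isDomainMarkov`).

The kernel `sleMarkovKernel κ D` is defined by a choice and is not measurable; on the classes
that matter (those described by the Loewner evolution through `φ`) its value in the `markov`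
clause is computed by a BOREL function of the class, read off through the driving function:
* `Φp`, `drivingPathClass`, `pastClassOf`, `futureLawOf`, `gval` — the read-off objects
  (`gval c = 𝟙[stopAt F c ∈ S] · K D (stopAt F c) T` on describable classes,
  `gval_eq_of_isLoewnerDescribable`);
* `measurable_gval` — Borel measurability (measurable parametrisation `psiTilde` of
  `SLEKernelFunctional`, parametrised compactified classes of `CompactifiedClassMeasurable`,
  sections of a product-measurable graph);
* `lintegral_indicator_sleMarkovKernel_eq` — transport of the kernel integral of a push-forward
  law carried by describable classes to the canonical space;
* `psiTilde_eq_of_eqOn` — `psiTilde Φ W r` only depends on `W` up to time `r`.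

References: W. Werner (2007), §3.2; G. F. Lawler (2005), §4.1, §6.3.
-/

noncomputable section

open Set Filter Topology MeasureTheory ProbabilityTheory Complex
open UpperHalfPlane (upperHalfPlaneSet isOpen_upperHalfPlaneSet)
open scoped NNReal ENNReal unitInterval

namespace Literature.Probability.RandomPlanarGeometry

/-! ### The Borel read-off of the kernel value through the driving function -/

section ReadOff

open scoped PathBorel

variable {κ : ℝ≥0} {D : DobrushinDomain} {φ : ConformalEquiv upperHalfPlaneSet D.carrier}

/-- `Φ` precomposed with the retraction onto the closed half-plane. [folklore] -/
def Φp (φ : ConformalEquiv upperHalfPlaneSet D.carrier) (z : ℂ) : ℂ :=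
  φ.boundaryExtension (Loewner.liftIm 0 z)

/-- `Φp` is continuous. [folklore] -/
theorem continuous_Φp (φ : ConformalEquiv upperHalfPlaneSet D.carrier) : Continuous (Φp φ) :=
  continuous_boundaryExtension_liftIm φ

/-- `Φp = Φ` on the closed half-plane. [folklore] -/
theorem Φp_eq_of_im_nonneg (φ : ConformalEquiv upperHalfPlaneSet D.carrier) {z : ℂ} (hz : 0 ≤ z.im) :
    Φp φ z = φ.boundaryExtension z := by
  rw [Φp, Loewner.liftIm_of_le hz]

/-- The driving function of a class, bundled as a continuous path. [folklore] -/
def drivingPathClass (φ : ConformalEquiv upperHalfPlaneSet D.carrier) (c : CurveClass ℂ) : C(ℝ≥0, ℝ) :=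
  ⟨drivingFunction φ c, continuous_drivingFunction φ c⟩

/-- **The stopped class read off a curve class**: the compactified image, under `Φp`, of the
pulled-back curve run up to time `r` (`t ↦ γ_c (r t/(1+t))`), with endpoint `Φp (γ_c r)` —
equal to the typed `stopAt` of the class for describable classes. [cite: Werner2007, §3.2] -/
def pastClassOf (φ : ConformalEquiv upperHalfPlaneSet D.carrier) (c : CurveClass ℂ) (r : ℝ≥0) :
    CurveClass ℂ :=
  compactifiedClass (Φp φ) (Φp φ (Loewner.trace (drivingFunction φ c) r))
    fun t ↦ Loewner.trace (drivingFunction φ c) (r * (t / (1 + t)))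

/-- **The future law read off a curve class**: the image law of the configuration
`(drivingFunction, r)` through the measurable parametrisation `psiTilde`. [cite: Werner2007, §3.2] -/
def futureLawOf (κ : ℝ≥0) (φ : ConformalEquiv upperHalfPlaneSet D.carrier) (c : CurveClass ℂ)
    (r : ℝ≥0) : Measure (CurveClass ℂ) :=
  sleImageLaw κ (psiTilde (Φp φ) (drivingPathClass φ c) r) (D.pt 1)

open Classical in
/-- **The measurable kernel value** `g(c)`: the value of
`c ↦ 𝟙[stopAt F c ∈ S] · sleMarkovKernel κ D (stopAt F c) T` computed through the driving
function of `c` (Borel in `c`; agrees with it on describable classes). [folklore] -/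
def gval (κ : ℝ≥0) (φ : ConformalEquiv upperHalfPlaneSet D.carrier) (F : Set ℂ)
    (S T : Set (CurveClass ℂ)) (c : CurveClass ℂ) : ℝ≥0∞ :=
  if traceHitTime φ (Φp φ ⁻¹' F) c = ⊤ then
    S.indicator (fun _ ↦ (1 : ℝ≥0∞)) c *
      T.indicator (fun _ ↦ (1 : ℝ≥0∞)) (CurveClass.mk (Curve.const (D.pt 1)))
  else
    S.indicator (fun _ ↦ (1 : ℝ≥0∞)) (pastClassOf φ c ((traceHitTime φ (Φp φ ⁻¹' F) c).untopD 0)) *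
      futureLawOf κ φ c ((traceHitTime φ (Φp φ ⁻¹' F) c).untopD 0) T


/-! #### Identification on describable classes -/

variable (hφ : D.IsChordalUniformizing φ)

/-- **A described class has a transient pull-back**: `c u = Φ (γ (u/(1-u))) → c 1 = b` as
`u → 1`, and `Φ` stays away from `b` on bounded parts of the closed half-plane. [folklore] -/
theorem IsLoewnerDescribed.tendsto_norm_atTop (hφ : D.IsChordalUniformizing φ) {W : ℝ≥0 → ℝ}
    {γ : ℝ≥0 → ℂ} (hγ : Loewner.IsGeneratedByCurve W γ) {c' : Curve ℂ}
    (himg : IsCompactifiedImage φ.boundaryExtension γ (D.pt 1) c') :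
    Tendsto (fun t ↦ ‖γ t‖) atTop atTop := by
  -- `Φ (γ t) = c' (t/(1+t)) → c' 1 = b`
  have hpt : ∀ t : ℝ≥0, φ.boundaryExtension (γ t) = c' ⟨(t : ℝ) / (1 + t), rayParamInv_mem_Icc t⟩ :=
    fun t ↦ by rw [himg.1 _ (rayParamInv_lt_one t), rayParam_rayParamInv]
  have hs : Tendsto (fun t : ℝ≥0 ↦ (⟨(t : ℝ) / (1 + t), rayParamInv_mem_Icc t⟩ : I)) atTop (𝓝 1) := by
    rw [tendsto_subtype_rng]
    change Tendsto (fun t : ℝ≥0 ↦ (t : ℝ) / (1 + t)) atTop (𝓝 (1 : ℝ))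
    have h1 : Tendsto (fun t : ℝ≥0 ↦ (1 : ℝ) - 1 / (1 + t)) atTop (𝓝 (1 - 0)) := by
      refine tendsto_const_nhds.sub ?_
      have h2 : Tendsto (fun t : ℝ≥0 ↦ (1 : ℝ) + t) atTop atTop :=
        tendsto_atTop_add_const_left _ _ (NNReal.tendsto_coe_atTop.2 tendsto_id)
      simpa using h2.inv_tendsto_atTop.const_mul (1 : ℝ)
    rw [sub_zero] at h1
    refine h1.congr fun t ↦ ?_
    have : (1 : ℝ) + t ≠ 0 := by positivity
    field_simp
    ring
  have hlim : Tendsto (fun t : ℝ≥0 ↦ φ.boundaryExtension (γ t)) atTop (𝓝 (D.pt 1)) := by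
    have h := (c'.toContinuousMap.continuous.tendsto 1).comp hs
    rw [show c'.toContinuousMap 1 = D.pt 1 from himg.2] at h
    exact h.congr fun t ↦ (hpt t).symm
  -- hence `γ` leaves every compact set
  have hcoc : Tendsto γ atTop (cocompact ℂ) := by
    refine (hasBasis_cocompact.tendsto_right_iff).2 fun K hK ↦ ?_
    set K' : Set ℂ := K ∩ {z : ℂ | 0 ≤ z.im} with hK'
    have hK'c : IsCompact K' := hK.inter_right (isClosed_le continuous_const continuous_im)
    have hcont : ContinuousOn φ.boundaryExtension K' :=
      ((JordanDomain.continuousOn_boundaryExtension_holds D.toJordanDomain φ).mono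
        (by rw [ConformalEquiv.closure_upperHalfPlaneSet_eq]; exact inter_subset_right))
    have himK : IsClosed (φ.boundaryExtension '' K') := (hK'c.image_of_continuousOn hcont).isClosed
    have hb : D.pt 1 ∉ φ.boundaryExtension '' K' := by
      rintro ⟨z, hz, hzb⟩
      exact MarkedDomain.boundaryExtension_ne_pt_one JordanDomain.exists_continuousOn_extension_holds
        hφ hz.2 hzb
    have hev : ∀ᶠ t in atTop, φ.boundaryExtension (γ t) ∈ (φ.boundaryExtension '' K')ᶜ :=
      hlim (himK.isOpen_compl.mem_nhds hb)
    filter_upwards [hev] with t ht htK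
    exact ht ⟨γ t, ⟨htK, hγ.im_nonneg t⟩, rfl⟩
  exact tendsto_norm_cocompact_atTop.comp hcoc

/-- The pulled-back curve of a describable class. [folklore] -/
theorem trace_drivingFunction_eq {c : CurveClass ℂ} {γ : ℝ≥0 → ℂ}
    (hγ : Loewner.IsGeneratedByCurve (drivingFunction φ c) γ) :
    Loewner.trace (drivingFunction φ c) = γ :=
  Loewner.IsGeneratedByCurve.trace_eq_holds (continuous_drivingFunction φ c) hγ

/-- **A describable class is the full curve of its driving function.** [folklore] -/
theorem eq_mk_fullCurve_of_isLoewnerDescribable {c : CurveClass ℂ} {γ : ℝ≥0 → ℂ}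
    (hγ : Loewner.IsGeneratedByCurve (drivingFunction φ c) γ) {c' : Curve ℂ} (hc : c = CurveClass.mk c')
    (himg : IsCompactifiedImage φ.boundaryExtension γ (D.pt 1) c')
    (htr : Tendsto (fun t ↦ ‖γ t‖) atTop atTop) :
    c = CurveClass.mk (fullCurve hφ hγ htr) :=
  hc.trans (congrArg CurveClass.mk (himg.unique (isCompactifiedImage_fullCurve hφ hγ htr)))

/-- `rayParam u / (1 + rayParam u) = u`. [folklore] -/
theorem rayParam_div_one_add (u : I) (hu : (u : ℝ) < 1) :
    (rayParam u : ℝ) / (1 + rayParam u) = u := by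
  rw [coe_rayParam]
  have h1 : (1 : ℝ) - u ≠ 0 := (sub_pos.2 hu).ne'
  field_simp
  ring

/-- **The read-off stopped class of a describable class is the class of its stopped curve.**
[folklore] -/
theorem pastClassOf_eq_mk_stoppedCurve {c : CurveClass ℂ} {γ : ℝ≥0 → ℂ}
    (hγ : Loewner.IsGeneratedByCurve (drivingFunction φ c) γ) (r : ℝ≥0) :
    pastClassOf φ c r = CurveClass.mk (stoppedCurve φ hγ r) := by
  unfold pastClassOf
  rw [trace_drivingFunction_eq hγ]
  refine IsCompactifiedImage.compactifiedClass_eq ⟨fun u hu ↦ ?_, ?_⟩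
  · rw [stoppedCurve_apply, Φp_eq_of_im_nonneg φ (hγ.im_nonneg _)]
    congr 3
    apply NNReal.eq
    rw [Real.coe_toNNReal _ u.2.1]
    push_cast
    rw [rayParam_div_one_add u hu]
  · rw [stoppedCurve_apply, Φp_eq_of_im_nonneg φ (hγ.im_nonneg _)]
    simp

/-- **`psiTilde` of the driving path is the parametrisation `ψ` of the configuration.** [folklore] -/
theorem psiTilde_drivingPathClass_eq {c : CurveClass ℂ} {γ : ℝ≥0 → ℂ}
    (hγ : Loewner.IsGeneratedByCurve (drivingFunction φ c) γ) (r : ℝ≥0) (w : ℂ) :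
    psiTilde (Φp φ) (drivingPathClass φ c) r w =
      (mkConfig hφ (continuous_drivingFunction φ c) hγ r).ψ w := by
  have hΦpc : ContinuousOn (Φp φ) {z : ℂ | 0 ≤ z.im} := (continuous_Φp φ).continuousOn
  rw [psiTilde_eq_of_isGeneratedByCurve hΦpc (W := drivingPathClass φ c) hγ r w]
  change Φp φ _ = (mkConfig hφ (continuous_drivingFunction φ c) hγ r).Φ
    (Loewner.bdryInv (drivingFunction φ c) r (projH w + (drivingFunction φ c r : ℂ)))
  rw [Φp_eq_of_im_nonneg φ]
  · rfl
  · exact (mkConfig hφ (continuous_drivingFunction φ c) hγ r).bdryInv_im_nonneg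
      ((mkConfig hφ (continuous_drivingFunction φ c) hγ r).projH_add_im_nonneg w)

/-- **The read-off future law of a describable class is the image law of its configuration.**
[folklore] -/
theorem futureLawOf_eq {c : CurveClass ℂ} {γ : ℝ≥0 → ℂ}
    (hγ : Loewner.IsGeneratedByCurve (drivingFunction φ c) γ) (r : ℝ≥0) :
    futureLawOf κ φ c r = sleImageLaw κ (mkConfig hφ (continuous_drivingFunction φ c) hγ r).ψ (D.pt 1) := by
  unfold futureLawOf
  congr 1
  funext w
  exact psiTilde_drivingPathClass_eq hφ hγ r w

/-- The `Φp`-preimage of `F` is closed. [folklore] -/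
theorem isClosed_preimage_Φp {F : Set ℂ} (hF : IsClosed F) : IsClosed (Φp φ ⁻¹' F) :=
  hF.preimage (continuous_Φp φ)

include hφ in
/-- **On describable classes the measurable kernel value IS the kernel value.** [cite: Werner2007, §3.2] -/
theorem gval_eq_of_isLoewnerDescribable (h0 : HasSLETrace κ)
    (htr' : ∀ᵐ ω ∂Process.preWienerMeasure, Tendsto (fun t ↦ ‖sleTrace κ ω t‖) atTop atTop) {F : Set ℂ} (hF : IsClosed F) (S : Set (CurveClass ℂ))
    {T : Set (CurveClass ℂ)} (hT : MeasurableSet T) {c : CurveClass ℂ} (hc : IsLoewnerDescribable φ c) :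
    gval κ φ F S T c =
      (CurveClass.stopAt F ⁻¹' S).indicator (fun c ↦ sleMarkovKernel κ D (CurveClass.stopAt F c) T) c := by
  classical
  obtain ⟨hW, γ, hγ, c', hcc', himg⟩ := isLoewnerDescribed_drivingFunction hc
  have htr := IsLoewnerDescribed.tendsto_norm_atTop hφ hγ himg
  have hfull := eq_mk_fullCurve_of_isLoewnerDescribable hφ hγ hcc' himg htr
  set A : Set ℂ := Φp φ ⁻¹' F with hA
  have hAc : IsClosed A := isClosed_preimage_Φp hF
  have htrace := trace_drivingFunction_eq hγ
  -- hitting facts in terms of `Φ ∘ γ`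
  have hmemA : ∀ s, Loewner.trace (drivingFunction φ c) s ∈ A ↔ φ.boundaryExtension (γ s) ∈ F := by
    intro s
    rw [htrace, hA, mem_preimage, Φp_eq_of_im_nonneg φ (hγ.im_nonneg s)]
  have hstopc : CurveClass.stopAt F c = CurveClass.stopAt F (CurveClass.mk (fullCurve hφ hγ htr)) :=
    congrArg (CurveClass.stopAt F) hfull
  by_cases htop : traceHitTime φ (Φp φ ⁻¹' F) c = ⊤
  · -- `F` is never hit
    have hnever : ∀ s, φ.boundaryExtension (γ s) ∉ F := fun s h ↦
      trace_notMem_of_traceHitTime_eq_top htop s ((hmemA s).2 h)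
    have hstop := (stopAt_startFrom_fullCurve_of_forall_notMem hφ hγ htr hF hnever).1
    have hker := sleMarkovKernel_stopAt_of_forall_notMem (κ := κ) hφ hγ htr hF hnever
    have hstop' : CurveClass.stopAt F c = c := by rw [hstopc, hstop, ← hfull]
    have hker' : sleMarkovKernel κ D c = Measure.dirac (CurveClass.mk (Curve.const (D.pt 1))) := by
      rw [hfull, ← hstop]
      exact hker
    rw [gval, if_pos htop]
    simp only [indicator_apply, mem_preimage, hstop', hker', Measure.dirac_apply' _ hT]
    by_cases hS : c ∈ S
    · simp [hS]
    · simp [hS]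
  · -- `F` is hit at a finite time `r`
    obtain ⟨r, hτr'⟩ := WithTop.ne_top_iff_exists.1 htop
    have hτr : traceHitTime φ A c = r := hτr'.symm
    have hr : (traceHitTime φ (Φp φ ⁻¹' F) c).untopD 0 = r := by
      change (traceHitTime φ A c).untopD 0 = r
      rw [hτr, WithTop.untopD_coe]
    have hhit : φ.boundaryExtension (γ r) ∈ F := (hmemA r).1 (trace_mem_of_traceHitTime_eq hAc hτr)
    have hbefore : ∀ s < r, φ.boundaryExtension (γ s) ∉ F := fun s hs h ↦
      trace_notMem_of_lt_traceHitTime (by rw [hτr]; exact_mod_cast hs) ((hmemA s).2 h)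
    have hstop := stopAt_fullCurve_of_hit hφ hγ htr hF hhit hbefore
    have hker := sleMarkovKernel_stopAt_of_hit (κ := κ) hφ hW hγ htr h0 htr' hF hhit hbefore
    have hstop' : CurveClass.stopAt F c = CurveClass.mk (stoppedCurve φ hγ r) := by rw [hstopc, hstop]
    have hker' : sleMarkovKernel κ D (CurveClass.mk (stoppedCurve φ hγ r)) =
        sleImageLaw κ (mkConfig hφ hW hγ r).ψ (D.pt 1) := by
      rw [← hstop]
      exact hker
    rw [gval, if_neg htop, hr]
    simp only [indicator_apply, mem_preimage, hstop', hker', pastClassOf_eq_mk_stoppedCurve (φ := φ) hγ,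
      futureLawOf_eq hφ hγ]
    by_cases hS : CurveClass.mk (stoppedCurve φ hγ r) ∈ S
    · simp only [hS, if_true, one_mul]
    · simp [hS]


end ReadOff

end Literature.Probability.RandomPlanarGeometry

end
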